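/-
Copyright: H21 programme, solo seat `solo-RiemannHypothesis-informed` (session 5).
-/
import Summits.RiemannHypothesis.RiemannHypothesis.Theorems.SoloInformedDeltaFree

/-!
# The δ-free wall, parameter-free forms (solo-informed, T38‴/T38⁗)

User-facing corollaries of T38 (`SoloInformedDeltaFree`) with the bump `ψ₁ = windowPlateau 1` and
either sign of the offset `η`:

* `riemannZeta_ne_zero_of_nearCount_offset_eff` (T38‴) — for `η ≠ 0`, `|η| < ½`,
  `N < |η|(p+1)`, `|γ₀| ≥ 1` and a window `a` with
  `nearCountWindow ψ₁ N p (deltaFree |η| a N) |η| γ₀ ≤ a`: if the off-line zeros of the zone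
  `|Im ρ − γ₀| < e^{a/(2p+2)}` other than `½ ± η + iγ₀` are among `≤ N` points and
  `weilGroundEnergy a ≥ 0`, then `ζ(½ + η + iγ₀) ≠ 0`.
* `riemannZeta_ne_zero_of_offline_encard_le` (T38⁗) — the same with the near hypothesis stated
  as a cardinality: the set of zeros `ρ` of `ζ` with `0 ≤ Re ρ ≤ 1`, `Re ρ ≠ ½`,
  `|Im ρ − γ₀| < e^{a/(2p+2)}` has at most `N + 2` elements.

Nothing else is assumed about the zeros of `ζ`.
-/

open MeasureTheory Complex Set Filter Topology Literature.NumberTheory.LFunctions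
open scoped ContDiff ComplexConjugate

namespace Summit.RiemannHypothesis.RiemannHypothesis.Theorems

/-- **T38‴ (parameter-free exclusion form, either sign of `η`).** -/
theorem riemannZeta_ne_zero_of_nearCount_offset_eff {η : ℝ} (hη0 : η ≠ 0) (hη : |η| < 1 / 2)
    (N p : ℕ) (hκ : (N : ℝ) < |η| * (p + 1)) :
    ∀ (γ₀ a : ℝ) (S' : Finset ℂ), 1 ≤ |γ₀| →
      nearCountWindow (windowPlateau 1) N p (deltaFree |η| a N) |η| γ₀ ≤ a → S'.card ≤ N →
      (∀ ρ : ℂ, riemannZeta ρ = 0 → 0 ≤ ρ.re → ρ.re ≤ 1 →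
          |ρ.im - γ₀| < Real.exp (a / (2 * p + 2)) → ρ.re ≠ 1 / 2 →
          ρ = 1 / 2 + η + γ₀ * I ∨ ρ = 1 / 2 - η + γ₀ * I ∨ ρ ∈ S') →
      0 ≤ weilGroundEnergy a → riemannZeta (1 / 2 + η + γ₀ * I) ≠ 0 := by
  have hpos : 0 < |η| := abs_pos.mpr hη0
  have hT := riemannZeta_ne_zero_of_nearCount_eff (ψ := windowPlateau 1)
    (contDiff_windowPlateau 1) (tsupport_windowPlateau_subset 1) (windowPlateau_nonneg 1) hpos hη
    (bumpLaplace_windowPlateau_one_pos |η|) N p hκ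
  intro γ₀ a S' hγ ha hcard hnear hE
  rcases le_or_gt 0 η with h | h
  · have e : |η| = η := abs_of_nonneg h
    rw [e] at hT ha
    exact hT γ₀ a S' hγ ha hcard hnear hE
  · have e : |η| = -η := abs_of_neg h
    rw [e] at hT ha
    intro hζ
    refine hT γ₀ a S' hγ ha hcard ?_ hE ?_
    · intro ρ hz h0 h1 hn hre
      push_cast
      rw [show (1 / 2 + -(η : ℂ) + γ₀ * I) = 1 / 2 - η + γ₀ * I by ring,
        show (1 / 2 - -(η : ℂ) + γ₀ * I) = 1 / 2 + η + γ₀ * I by ring]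
      rcases hnear ρ hz h0 h1 hn hre with h' | h' | h'
      · exact Or.inr (Or.inl h')
      · exact Or.inl h'
      · exact Or.inr (Or.inr h')
    · push_cast
      rw [show (1 / 2 + -(η : ℂ) + γ₀ * I) = 1 / 2 - η + γ₀ * I by ring]
      exact riemannZeta_zero_reflect hη hζ

/-- **T38⁗ (count form).**  With `ψ₁ = windowPlateau 1`: for `η ≠ 0`, `|η| < ½`,
`N < |η|(p+1)`, `|γ₀| ≥ 1` and `a` with `nearCountWindow ψ₁ N p (deltaFree |η| a N) |η| γ₀ ≤ a`,
if the zeros `ρ` of `ζ` with `0 ≤ Re ρ ≤ 1`, `Re ρ ≠ ½`, `|Im ρ − γ₀| < e^{a/(2p+2)}` number at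
most `N + 2` and `weilGroundEnergy a ≥ 0`, then `ζ(½ + η + iγ₀) ≠ 0`. -/
theorem riemannZeta_ne_zero_of_offline_encard_le {η : ℝ} (hη0 : η ≠ 0) (hη : |η| < 1 / 2)
    (N p : ℕ) (hκ : (N : ℝ) < |η| * (p + 1)) :
    ∀ (γ₀ a : ℝ), 1 ≤ |γ₀| →
      nearCountWindow (windowPlateau 1) N p (deltaFree |η| a N) |η| γ₀ ≤ a →
      {ρ : ℂ | riemannZeta ρ = 0 ∧ 0 ≤ ρ.re ∧ ρ.re ≤ 1 ∧ ρ.re ≠ 1 / 2 ∧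
          |ρ.im - γ₀| < Real.exp (a / (2 * p + 2))}.encard ≤ ((N + 2 : ℕ) : ℕ∞) →
      0 ≤ weilGroundEnergy a → riemannZeta (1 / 2 + η + γ₀ * I) ≠ 0 := by
  intro γ₀ a hγ ha hcount hE hζ
  classical
  set Z : Set ℂ := {ρ : ℂ | riemannZeta ρ = 0 ∧ 0 ≤ ρ.re ∧ ρ.re ≤ 1 ∧ ρ.re ≠ 1 / 2 ∧
    |ρ.im - γ₀| < Real.exp (a / (2 * p + 2))} with hZ_def
  have hfin : Z.Finite := Set.finite_of_encard_le_coe hcount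
  have hlt := abs_lt.mp hη
  have hζ1 : riemannZeta (1 / 2 - η + γ₀ * I) = 0 := riemannZeta_zero_reflect hη hζ
  have hmem : ∀ σ : ℝ, σ ≠ 0 → |σ| < 1 / 2 → riemannZeta (1 / 2 + σ + γ₀ * I) = 0 →
      (1 / 2 + σ + γ₀ * I : ℂ) ∈ Z := by
    intro σ hσ0 hσ hz
    have hs := abs_lt.mp hσ
    have hre : (1 / 2 + σ + γ₀ * I : ℂ).re = 1 / 2 + σ := by simp
    have him : (1 / 2 + σ + γ₀ * I : ℂ).im = γ₀ := by simp
    refine ⟨hz, ?_, ?_, ?_, ?_⟩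
    · rw [hre]; linarith
    · rw [hre]; linarith
    · rw [hre]; intro h; exact hσ0 (by linarith)
    · rw [him, sub_self, abs_zero]; exact Real.exp_pos _
  have h0mem : (1 / 2 + η + γ₀ * I : ℂ) ∈ Z := hmem η hη0 hη hζ
  have h1mem : (1 / 2 - η + γ₀ * I : ℂ) ∈ Z := by
    have := hmem (-η) (neg_ne_zero.mpr hη0) (by rwa [abs_neg])
      (by push_cast; rwa [← sub_eq_add_neg])
    push_cast at this
    rwa [← sub_eq_add_neg] at this
  have hne : (1 / 2 - η + γ₀ * I : ℂ) ≠ 1 / 2 + η + γ₀ * I := by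
    intro h
    have := congrArg Complex.re h
    simp at this
    exact hη0 (by linarith)
  set F : Finset ℂ := hfin.toFinset with hF_def
  set S : Finset ℂ := (F.erase (1 / 2 + η + γ₀ * I)).erase (1 / 2 - η + γ₀ * I) with hS_def
  have h0F : (1 / 2 + η + γ₀ * I : ℂ) ∈ F := hfin.mem_toFinset.mpr h0mem
  have h1F : (1 / 2 - η + γ₀ * I : ℂ) ∈ F.erase (1 / 2 + η + γ₀ * I) :=
    Finset.mem_erase.mpr ⟨hne, hfin.mem_toFinset.mpr h1mem⟩
  have hcardF : F.card ≤ N + 2 := by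
    have h := hfin.encard_eq_coe_toFinset_card
    rw [h] at hcount
    exact_mod_cast hcount
  have hcardS : S.card ≤ N := by
    have e1 := Finset.card_erase_of_mem h1F
    have e0 := Finset.card_erase_of_mem h0F
    rw [hS_def, e1, e0]
    omega
  refine riemannZeta_ne_zero_of_nearCount_offset_eff hη0 hη N p hκ γ₀ a S hγ ha hcardS ?_ hE hζ
  intro ρ hz h0 h1 hn hre
  by_cases hρ0 : ρ = 1 / 2 + η + γ₀ * I
  · exact Or.inl hρ0
  by_cases hρ1 : ρ = 1 / 2 - η + γ₀ * I
  · exact Or.inr (Or.inl hρ1)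
  refine Or.inr (Or.inr ?_)
  rw [hS_def, Finset.mem_erase, Finset.mem_erase]
  exact ⟨hρ1, hρ0, hfin.mem_toFinset.mpr ⟨hz, h0, h1, hre, hn⟩⟩

end Summit.RiemannHypothesis.RiemannHypothesis.Theorems
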